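import Mathlib
import Summits.Langlands.Langlands.Theorems.IwahoriTransientExpCharpoly
import Summits.Langlands.Langlands.Theorems.IwahoriTransientGalois
import Summits.Langlands.Langlands.Theses.PrimeSwitchSplit
import Literature.NumberTheory.GaloisRepresentations.DecompositionGroupOfCompletion
import Literature.NumberTheory.Automorphic.IwahoriGL

/-!
# DAG edge (part 2/3: junctions + the edge) `IwahoriDictionary (S5) ⟸ CRD ∧ L∤R ∧ P(i) ∧ IWD-A ∧ IWD-B1a ∧ IWD-B1b ∧ IWD-B2` and
`SemistableShaping ⟸ W⁺ ∧ L∤R ∧ P(i) ∧ CRD ∧ IWD-A ∧ IWD-B1a ∧ IWD-B1b ∧ IWD-B2` (decomp-langlands, lens-3 gen 27; v2: IWD-A / IWD-B1a re-typed with the cuspidal local-component hypothesis, crit-1 row 430)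

The gen-26 DAG edge (`SemistableShapingOfAvatars.lean`, HOME/lens-3/g26/dag) proved the gen-25 deciding piece SSH = `SemistableShaping` of
U = `AuxiliaryLevelSplit.LevelFiniteness` (stmt-Langlands-27042) from W⁺ (`PrimeSwitchSplit.SatakeAvatarExistence`, 17415), Satake uniqueness
(proved) and ONE genuine residual S5 = `IwahoriDictionary` ("the exact local dictionary at the transient places").  This file removes S5 as a
residual: it is implied by three N0 host items — CRD (`CanonicalReciprocityData`, 17930), P (`PadicMemberCompatibility`, 17534, conjunct (i)
only) and L∤R (`CompatibilityAwayFromLR`, 18084) — together with four typed JUNCTION cells of print / tree status: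

* IWD-A `IwahoriFixedOfInertiaTrivialParameter` — PRINT (Harris–Taylor/Henniart `rec`, Rodier, Bernstein–Zelevinsky, Borel 1976 Lemma 4.7):
  a Frobenius-semisimple parameter trivial on inertia has an Iwahori-fixed vector;
* IWD-B1a `SphericalOfUnramifiedParameter` — PRINT (LLC for `GL_n` is compatible with the unramified/Satake correspondence): an unramified
  Frobenius-semisimple parameter (`N = 0`, `ρ|_I = 1`) is the parameter of a `GL_n(𝒪_v)`-spherical `πv`;
* IWD-B1b `UnramifiedOfSphericalLocalComponent` — PRINT (Flath / Borel–Jacquet 4.6; converse direction of the tree's named fact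
  `hasLocalComponentAt_spherical_of_hasSatakeParamAt`): a spherical local component at `v` makes the cuspidal `π` unramified at `v`;
* IWD-B2 `SatakeOfSphericalLocalGlobal` — at an unramified place `v ∤ ℓ` of `π`, local–global compatibility ⇒ Satake–Frobenius compatibility:
  PRINT at `n = 1` (Hecke characters), a TREE THEOREM at `n = 2`, the tree theorem modulo the Jacquet–Shalika named fact at `n ≥ 3`
  (`ReciprocityUpToIrreducibility.satakeFrobCompatibleAt_of_localGlobalCompatibleAt_away_of_unramifiedComputation`; companion file
  `IwahoriDictionaryEdgeB2.lean`, separate only because that tree module is not yet built on the check farm).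

PROVED here (no junction): §A the linear algebra `charpoly (A·exp(sN)) = charpoly A` for `A N = c • N A` (`c` of infinite order) and the
exact `c`-pair of eigenvalues `μ, cμ` of `A` when `N ≠ 0`; §B the Grothendieck–Deligne recipe with unipotent inertia gives `r.ρ|_{I} = 1`;
§D the edge itself (place transport `𝔓₀ = adicCompletionPrime`, `I_{𝔓₀} = res I_{K_v}`; `N = 0` ⇒ unramified F-ss parameter by the tree's
`WeilDeligneOfGaloisUnramifiedProofs`; `N ≠ 0` ⇒ the `q_v`-pair among the roots of `charpoly ρ'(Frob_𝔓)` for EVERY `𝔓 ∣ v` and every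
arithmetic Frobenius, via Galois conjugation of decomposition data); §E the gen-26 composition (verbatim) and
`levelFiniteness_of_host : W⁺ → P → L∤R → CRD → IWD-A → IWD-B1a → IWD-B1b → IWD-B2 → ILC → LevelFiniteness` through the tree's `closes_target`.

See the node card `IwahoriDictionaryEdge.md` (necessity, sources with page labels, grading ask).  Everything below is sorry-free; axioms standard.
-/

set_option linter.dupNamespace false
set_option linter.unusedVariables false
set_option linter.unusedSectionVars false

namespace Summit.Langlands.Langlands.Theorems.IwahoriTransient

open scoped Polynomial Matrix Pointwise
open Polynomial

namespace DictEdge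

/-! ## §C. The junctions of the Iwahori–Weil–Deligne dictionary (typed; print / tree status in each docstring) and S5 -/

section Junctions

open Literature.NumberTheory.GaloisRepresentations Literature.NumberTheory.Automorphic IsDedekindDomain

/-- **IWD-A (print junction): a Frobenius-semisimple parameter trivial on inertia has an Iwahori-fixed vector — for LOCAL COMPONENTS OF
CUSPIDAL `π`.**  For every reciprocity datum `Rec`, every finite place `v` of a number field `K` and every irreducible smooth `πv` of `GL_n(K_v)`
which IS THE LOCAL COMPONENT AT `v` OF A CUSPIDAL `π` (`π.1.HasLocalComponentAt v πv.ρ`; such `πv` are GENERIC — Shalika 1974 Thm 5.5 /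
Piatetski-Shapiro 1979 — and on generic classes `rec_v` is pinned by the `L`/`ε`-factors of pairs demanded by `IsLocalLanglandsGL`, Henniart 1993
Thm 1.1; without this hypothesis the cell would quantify over non-generic classes, where the tree's `IsLocalLanglandsGL` does not pin `rec`, and be
false jointly with CRD — crit-1 row 430): if
`rec_v(πv)` is the class of a Frobenius-semisimple Weil–Deligne representation `r'` with `r'.ρ` UNRAMIFIED (`= 1` on `I_{K_v}`; the
monodromy `N` is arbitrary), then `πv` has a non-zero vector fixed by the standard Iwahori subgroup `iwahoriGL n K_v`.  In print:
`rec_{K_v}` is unique (Henniart) and is Rodier's extension of the supercuspidal correspondence,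
`rec(Sp_{s₁}(π₁) ⊞ ⋯ ⊞ Sp_{s_t}(π_t)) = ⊕ rec(π_i) ⊗ Sp_{s_i}` (Harris–Taylor 2001, p. 231 and Thm VII.2.20), so `r'.ρ|_I = 1` forces every
`rec(π_i)` to be an unramified CHARACTER (irreducible and trivial on inertia ⇒ one-dimensional; property (1) `rec(χ) = χ ∘ Art⁻¹`), i.e.
`πv` has supercuspidal support made of unramified characters of `GL₁`, i.e. is a subquotient of an unramified principal series
(Bernstein–Zelevinsky 1977, Zelevinsky 1980), i.e. has a non-zero Iwahori-fixed vector (Borel 1976, Lemma 4.7: "any subquotient of an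
unramified principal series contains a nonzero Iwahori fixed vector"; Casselman 1980). [ref: HarrisTaylorAMS2001, Thm A and p. 231 (Rodier's
definition of rec_K)] [ref: Borel1976, Lemma 4.7] [ref: Zelevinsky1980, Thm 6.1] -/
def IwahoriFixedOfInertiaTrivialParameter : Prop :=
  ∀ (K : Type) [Field K] [NumberField K] (Rec : Summit.Langlands.ReciprocityData K) (n : ℕ)
    (hcpt : isCompact_glFiniteIntegralLevel n K) (π : CuspidalAutomorphicRepData n K hcpt)
    (v : HeightOneSpectrum (NumberField.RingOfIntegers K))
    (πv : SmoothIrrep (GL (Fin n) (v.adicCompletion K)))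
    (r' : WeilDeligneRep (v.adicCompletion K) ℂ (Fin n → ℂ)) (hr' : r'.IsFrobSemisimple),
    π.1.HasLocalComponentAt v πv.ρ → WeilGroup.IsUnramifiedRep r'.ρ →
    (Rec.llc v).recGL n (IrrClass.mk πv) = Quotient.mk (frobSemisimpleWDSetoid (v.adicCompletion K) n) ⟨r', hr'⟩ →
    ∃ w : πv.V, w ≠ 0 ∧ ∀ g ∈ iwahoriGL n (v.adicCompletion K), πv.ρ g w = w

/-- **IWD-B1a (print junction, local): an UNRAMIFIED parameter (`N = 0`, `ρ|_I = 1`) is the parameter of a SPHERICAL representation — for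
LOCAL COMPONENTS OF CUSPIDAL `π`.**  For every reciprocity datum `Rec`, finite place `v` and irreducible smooth `πv` of `GL_n(K_v)` which is the local
component at `v` of a cuspidal `π` (`π.1.HasLocalComponentAt v πv.ρ`: generic, so `rec_v(πv)` is pinned — same remark as IWD-A): if `rec_v(πv)` is the class of a
Frobenius-semisimple `r'` with `r'.N = 0` and `r'.ρ` unramified, then `πv` has a non-zero vector fixed by `GL_n(𝒪_v)` (the subgroup is
written exactly as in the tree's named fact `AutomorphicRepData.hasLocalComponentAt_spherical_of_hasSatakeParamAt`).  In print: for `GL_n`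
the local Langlands correspondence (Harris–Taylor; unique by Henniart, and `ReciprocityData` is Henniart-normalised) is compatible with the
unramified (Satake) correspondence — an unramified `L`-parameter (trivial on `I_F × SL₂`) corresponds to the unique `GL_n(𝒪)`-spherical
subquotient `J(λ)` (Getz–Hahn 2024, Def. 12.4 and §12.5; Harris–Taylor 2001 p. 231, Rodier's `rec(Sp_{s₁}(π₁) ⊞ ⋯)` with all `s_i = 1` and
property (1) `rec₁(χ) = χ ∘ Art⁻¹`).  [ref: HarrisTaylorAMS2001, Thm A and p. 231] [ref: GetzHahn2024, Def. 12.4, §12.5]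
[ref: HenniartInventiones2000, Thm 1.2] -/
def SphericalOfUnramifiedParameter : Prop :=
  ∀ (K : Type) [Field K] [NumberField K] (Rec : Summit.Langlands.ReciprocityData K) (n : ℕ)
    (hcpt : isCompact_glFiniteIntegralLevel n K) (π : CuspidalAutomorphicRepData n K hcpt)
    (v : HeightOneSpectrum (NumberField.RingOfIntegers K))
    (πv : SmoothIrrep (GL (Fin n) (v.adicCompletion K)))
    (r' : WeilDeligneRep (v.adicCompletion K) ℂ (Fin n → ℂ)) (hr' : r'.IsFrobSemisimple),
    π.1.HasLocalComponentAt v πv.ρ → r'.N = 0 → WeilGroup.IsUnramifiedRep r'.ρ →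
    (Rec.llc v).recGL n (IrrClass.mk πv) = Quotient.mk (frobSemisimpleWDSetoid (v.adicCompletion K) n) ⟨r', hr'⟩ →
    ∃ x : πv.V, x ≠ 0 ∧ ∀ g ∈ (Matrix.GeneralLinearGroup.map
      ((v.adicCompletionIntegers K).subtype : v.adicCompletionIntegers K →+* v.adicCompletion K)).range, πv.ρ g x = x

/-- **IWD-B1b (print junction, local-to-adelic): a SPHERICAL local component makes the cuspidal `π` unramified at `v`.**  If the cuspidal
`π` of `GL_n/K` has local component `πv` at `v` (`HasLocalComponentAt`, Borel–Jacquet model) and `πv` has a non-zero `GL_n(𝒪_v)`-fixed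
vector, then `π` is unramified at `v` (`AutomorphicRepData.IsUnramifiedAt`: a `K(𝔫)`-fixed Hecke eigenform modulo `W'` at some level `𝔫`
prime to `v`, with eigenvalues `q_v^{i(n-i)/2} e_i(α)`).  This is the CONVERSE direction of the tree's named fact
`AutomorphicRepData.hasLocalComponentAt_spherical_of_hasSatakeParamAt` (Flath 1979, Thm 3–4; Borel–Jacquet 1979, 4.6): `π ≅ π_∞ ⊗ ⊗'_w π_w`
with `π_v ≅ πv` spherical, so `π^{K(𝔫)} ⊇ πv^{GL_n(𝒪_v)} ⊗ ⊗_{w ≠ v} π_w^{K(𝔫)_w} ≠ 0` for `𝔫` prime to `v` and deep at the other ramified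
places, and the spherical Hecke algebra at `v` acts on it through the Satake character of `πv` (Satake; Tamagawa 1963).
[ref: FlathCorvallis1979, Thm 3–4] [ref: BorelJacquetCorvallis1979, §4.6] [ref: Tamagawa1963] -/
def UnramifiedOfSphericalLocalComponent : Prop :=
  ∀ (K : Type) [Field K] [NumberField K] (n : ℕ) (hcpt : isCompact_glFiniteIntegralLevel n K)
    (π : CuspidalAutomorphicRepData n K hcpt) (v : HeightOneSpectrum (NumberField.RingOfIntegers K))
    (πv : SmoothIrrep (GL (Fin n) (v.adicCompletion K))),
    π.1.HasLocalComponentAt v πv.ρ →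
    (∃ x : πv.V, x ≠ 0 ∧ ∀ g ∈ (Matrix.GeneralLinearGroup.map
      ((v.adicCompletionIntegers K).subtype : v.adicCompletionIntegers K →+* v.adicCompletion K)).range, πv.ρ g x = x) →
    π.1.IsUnramifiedAt v

/-- **IWD-B2 at rank `n` (junction; print for `n = 1`, TREE for `n ≥ 2` modulo JS): at a place `v ∤ ℓ` where `π` is UNRAMIFIED,
local–global compatibility gives Satake–Frobenius compatibility.**  For `2 ≤ n` this is the tree theorem
`ReciprocityUpToIrreducibility.satakeFrobCompatibleAt_of_localGlobalCompatibleAt_away_of_unramifiedComputation` modulo the named Literature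
fact `hasRSLFactor_of_isSatakeParameter_haar` (Jacquet–Shalika 1981 §2; its `(2,1)` instance `hasRSLFactor_of_isSatakeParameter_haar_two_one`
is proved, so `n = 2` is unconditional) — companion file `IwahoriDictionaryEdgeB2.lean`; the rank-one instance (Hecke characters:
`rec₁(χ) = χ ∘ Art⁻¹`, Harris–Taylor Thm A (i); Tate, Corvallis (4.1.3)) is print. [ref: HarrisTaylorAMS2001, Thm A (i)]
[ref: BuzzardGeeLMS2014, Conj. 3.2.1–3.2.2] [ref: JacquetShalika1981, §2] -/
def SatakeOfSphericalLocalGlobalRank (n : ℕ) : Prop :=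
  ∀ (K : Type) [Field K] [NumberField K] (Rec : Summit.Langlands.ReciprocityData K)
    (hcpt : isCompact_glFiniteIntegralLevel n K) (π : CuspidalAutomorphicRepData n K hcpt)
    (ℓ : ℕ) [Fact ℓ.Prime] (ι : PadicAlgCl ℓ ≃+* ℂ) (ρ : FramedGaloisRep K (PadicAlgCl ℓ) n)
    (v : HeightOneSpectrum (NumberField.RingOfIntegers K)),
    ((ℓ : ℕ) : NumberField.RingOfIntegers K) ∉ v.asIdeal → π.1.IsUnramifiedAt v →
    Summit.Langlands.LocalGlobalCompatibleAt Rec ι π.1 ρ v → Summit.Langlands.SatakeFrobCompatibleAt ι π.1 ρ v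

/-- **IWD-B2 (all positive ranks).**  `n = 1`: print junction (Hecke characters); `n = 2`: a TREE theorem; `n ≥ 3`: the tree theorem
modulo the Jacquet–Shalika named fact — see the companion file `IwahoriDictionaryEdgeB2.lean` (`satakeOfSphericalLocalGlobalRank_two`,
`satakeOfSphericalLocalGlobalRank_of_JS`, by name from
`ReciprocityUpToIrreducibility.satakeFrobCompatibleAt_of_localGlobalCompatibleAt_away_of_unramifiedComputation`; kept separate only because that
tree module is not yet built on the check farm). [ref: HarrisTaylorAMS2001, Thm A] [ref: JacquetShalika1981, §2] -/
def SatakeOfSphericalLocalGlobal : Prop :=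
  ∀ n : ℕ, 0 < n → SatakeOfSphericalLocalGlobalRank n

/-- S5 — the gen-26 residual `IwahoriDictionary` (verbatim `Dag.stub_iwahoriDictionary`, dag_stubs.json key "S5"). [new] -/
def IwahoriDictionary : Prop :=
  ∀ (K : Type) [Field K] [NumberField K] (n : ℕ) (hcpt : Literature.NumberTheory.Automorphic.isCompact_glFiniteIntegralLevel n K), 0 < n → ∀ (π : Literature.NumberTheory.Automorphic.CuspidalAutomorphicRepData n K hcpt), π.1.IsLAlgebraic → ∀ (ℓ : ℕ) [Fact ℓ.Prime] (ι : PadicAlgCl ℓ ≃+* ℂ) (ρ' : Literature.NumberTheory.GaloisRepresentations.FramedGaloisRep K (PadicAlgCl ℓ) n), ρ'.toGaloisRep.IsIrreducible → (∀ᶠ v : IsDedekindDomain.HeightOneSpectrum (NumberField.RingOfIntegers K) in Filter.cofinite, Summit.Langlands.SatakeFrobCompatibleAt ι π.1 ρ' v) → ∀ v : IsDedekindDomain.HeightOneSpectrum (NumberField.RingOfIntegers K), ((ℓ : ℕ) : NumberField.RingOfIntegers K) ∉ v.asIdeal → (∀ 𝔓 ∈ v.primesAbove, ∀ τ ∈ 𝔓.inertia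 (Field.absoluteGaloisGroup K), IsNilpotent (((ρ' τ : GL (Fin n) (PadicAlgCl ℓ)) : Matrix (Fin n) (Fin n) (PadicAlgCl ℓ)) - 1)) → (∃ πv : Literature.NumberTheory.Automorphic.SmoothIrrep (Matrix.GeneralLinearGroup (Fin n) (v.adicCompletion K)), π.1.HasLocalComponentAt v πv.ρ ∧ ∃ w : πv.V, w ≠ 0 ∧ ∀ g ∈ Literature.NumberTheory.Automorphic.iwahoriGL n (v.adicCompletion K), πv.ρ g w = w) ∧ (Summit.Langlands.SatakeFrobCompatibleAt ι π.1 ρ' v ∨ ∀ 𝔓 ∈ v.primesAbove, ∀ σ : Field.absoluteGaloisGroup K, IsArithFrobAt (NumberField.RingOfIntegers K) σ 𝔓 → ∃ a b : PadicAlgCl ℓ, ({a, b} : Multiset (PadicAlgCl ℓ)) ≤ (Literature.NumberTheory.GaloisRepresentations.FramedRep.charpoly ρ' σ).roots ∧ a = (v.residueCard : PadicAlgCl ℓ) * b)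

end Junctions

/-! ## §D. The edge `S5 ⟸ CRD ∧ P(i) ∧ L∤R ∧ IWD-A ∧ IWD-B1a ∧ IWD-B1b ∧ IWD-B2` -/

section Main

open Literature.NumberTheory.GaloisRepresentations Literature.NumberTheory.Automorphic IsDedekindDomain
open Summit.Langlands.Langlands.Theses.PrimeSwitchSplit

/-- Transport of the global unipotent-inertia hypothesis to the Weil inertia of `K_v` (`𝔓₀ = adicCompletionPrime`, `I_{𝔓₀} = res I_{K_v}`). -/
theorem weil_inertia_unipotent {K : Type} [Field K] [NumberField K] {ℓ : ℕ} [Fact ℓ.Prime] {n : ℕ}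
    (ρ' : FramedGaloisRep K (PadicAlgCl ℓ) n) (v : HeightOneSpectrum (NumberField.RingOfIntegers K))
    (hunip : ∀ 𝔓 ∈ v.primesAbove, ∀ τ ∈ 𝔓.inertia (Field.absoluteGaloisGroup K),
      IsNilpotent (((ρ' τ : GL (Fin n) (PadicAlgCl ℓ)) : Matrix (Fin n) (Fin n) (PadicAlgCl ℓ)) - 1)) :
    ∀ u ∈ WeilGroup.inertia (v.adicCompletion K),
      IsNilpotent ((((ρ'.toLocal v).toWeilGroupHom u : GL (Fin n) (PadicAlgCl ℓ)) : Matrix (Fin n) (Fin n) (PadicAlgCl ℓ)) - 1) := by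
  intro u hu
  have h1 : absGaloisRestrict K (v.adicCompletion K) (WeilGroup.toAbsGalois _ u) ∈
      (adicCompletionPrime K v).inertia (Field.absoluteGaloisGroup K) := by
    rw [inertia_adicCompletionPrime_eq_map_absInertia]
    exact Subgroup.mem_map.mpr ⟨_, WeilGroup.mem_inertia_iff.mp hu, rfl⟩
  exact hunip _ (adicCompletionPrime_mem_primesAbove K v) _ h1

/-- `N ≠ 0` branch: `charpoly ρ'(Frob_𝔓)` has an EXACT `q_v`-pair of roots. -/
theorem qpair_of_N_ne_zero {K : Type} [Field K] [NumberField K] {ℓ : ℕ} [Fact ℓ.Prime] {n : ℕ}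
    (ρ' : FramedGaloisRep K (PadicAlgCl ℓ) n) (v : HeightOneSpectrum (NumberField.RingOfIntegers K))
    (r : WeilDeligneRep (v.adicCompletion K) (PadicAlgCl ℓ) (Fin n → PadicAlgCl ℓ))
    (hrec : IsWeilDeligneOfLadic ((ρ'.toLocal v).toWeilGroupHom) r) (hN : r.N ≠ 0)
    (hI : ∀ u ∈ WeilGroup.inertia (v.adicCompletion K), r.ρ u = 1)
    {𝔓 : Ideal (absIntegers (NumberField.RingOfIntegers K) K)} (h𝔓 : 𝔓 ∈ v.primesAbove)
    {σ : Field.absoluteGaloisGroup K} (hσ : IsArithFrobAt (NumberField.RingOfIntegers K) σ 𝔓) :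
    ∃ a b : PadicAlgCl ℓ, ({a, b} : Multiset (PadicAlgCl ℓ)) ≤ (FramedRep.charpoly ρ' σ).roots ∧ a = (v.residueCard : PadicAlgCl ℓ) * b := by
  have hmul : IsFrobPow.mul (F := v.adicCompletion K) := IsFrobPow.mul_holds
  have huniq : IsFrobPow.unique (F := v.adicCompletion K) := IsFrobPow.unique_holds
  -- (1) move `σ` to an arithmetic Frobenius at `𝔓₀ = adicCompletionPrime` inside `D_{𝔓₀} = res Γ_{K_v}`, then into `W_{K_v}`
  obtain ⟨g, rfl⟩ := HeightOneSpectrum.exists_smul_eq_of_mem_primesAbove_holds (adicCompletionPrime_mem_primesAbove K v) h𝔓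
  have hσ₀ : IsArithFrobAt (NumberField.RingOfIntegers K) (g⁻¹ * σ * g) (adicCompletionPrime K v) := by
    have := hσ.conj g⁻¹
    simpa only [inv_inv, inv_smul_smul] using this
  have hmem : g⁻¹ * σ * g ∈ (absGaloisRestrict K (v.adicCompletion K)).range := by
    rw [← decompositionSubgroup_adicCompletionPrime_eq_range]
    exact hσ₀.mem_stabilizer
  obtain ⟨σl, hσl⟩ := hmem
  have hσl' : absGaloisRestrict K (v.adicCompletion K) σl = g⁻¹ * σ * g := hσl
  have hq : IsNonarchimedeanLocalField.residueFieldCard (v.adicCompletion K) = Nat.card (NumberField.RingOfIntegers K ⧸ v.asIdeal) := by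
    rw [residueFieldCard_adicCompletion_eq, HeightOneSpectrum.residueCard_eq_card_quotient]
  have hFrob : IsAbsArithFrob σl :=
    (isArithFrobAt_absGaloisRestrict_adicCompletionPrime_iff K v hq σl).mp (by rw [hσl']; exact hσ₀)
  have h1 : IsFrobPow σl 1 := isFrobPow_one_iff_isAbsArithFrob_holds.mpr hFrob
  set w : WeilGroup (v.adicCompletion K) := WeilGroup.mk σl ⟨1, h1⟩ with hw
  have hdegw : WeilGroup.deg w = 1 :=
    (WeilGroup.deg_eq_iff hmul huniq).mpr (by rw [hw, WeilGroup.toAbsGalois_mk]; exact h1)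
  have hval : ρ' (g⁻¹ * σ * g) = (ρ'.toLocal v).toWeilGroupHom w := by
    rw [FramedRep.toWeilGroupHom_apply, FramedGaloisRep.toLocal_apply, hw, WeilGroup.toAbsGalois_mk]
    exact congrArg ρ' hσl'.symm
  -- (2) the recipe at `Φ⁻¹·(Φ w)`: `ρ_W(w) = A · exp(s N)` with `A = [r.ρ Φ⁻¹]`, `A N = q N A`
  obtain ⟨t, U, Φ, hUI, hUo, hΦ, ht, hU, hρ⟩ := hrec
  set Nm : Matrix (Fin n) (Fin n) (PadicAlgCl ℓ) := LinearMap.toMatrix' r.N with hNm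
  have hNmn : IsNilpotent Nm := r.isNilpotent_N.map LinearMap.toMatrixAlgEquiv'
  have hNm0 : Nm ≠ 0 := fun h => hN ((LinearEquiv.map_eq_zero_iff LinearMap.toMatrix').mp h)
  have hu : Φ * w ∈ WeilGroup.inertia (v.adicCompletion K) := by
    rw [← WeilGroup.deg_eq_zero_iff_mem_inertia hmul huniq, WeilGroup.deg_mul hmul huniq, hΦ, hdegw]; norm_num
  have e1 : Φ ^ (-1 : ℤ) * (Φ * w) = w := by rw [zpow_neg_one, inv_mul_cancel_left]
  set s : PadicAlgCl ℓ := (t ⟨Φ * w, hu⟩).toAdd with hs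
  have key : LinearMap.toMatrix' (r.ρ (Φ ^ (-1 : ℤ) * (Φ * w))) =
      (((ρ'.toLocal v).toWeilGroupHom (Φ ^ (-1 : ℤ) * (Φ * w)) : GL (Fin n) (PadicAlgCl ℓ)) : Matrix (Fin n) (Fin n) (PadicAlgCl ℓ)) *
        IsNilpotent.exp (-(s • Nm)) := hρ (-1) ⟨Φ * w, hu⟩
  rw [e1] at key
  set A : Matrix (Fin n) (Fin n) (PadicAlgCl ℓ) := LinearMap.toMatrix' (r.ρ (Φ ^ (-1 : ℤ))) with hA
  have hRw : LinearMap.toMatrix' (r.ρ w) = A := by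
    rw [← e1, map_mul, LinearMap.toMatrix'_mul, hI _ hu, LinearMap.toMatrix'_one, mul_one]
  have hsN : IsNilpotent (s • Nm) := hNmn.smul s
  have hM : (((ρ'.toLocal v).toWeilGroupHom w : GL (Fin n) (PadicAlgCl ℓ)) : Matrix (Fin n) (Fin n) (PadicAlgCl ℓ)) =
      A * IsNilpotent.exp (s • Nm) := by
    have e2 : IsNilpotent.exp (-(s • Nm)) * IsNilpotent.exp (s • Nm) = 1 := IsNilpotent.exp_neg_mul_exp_self hsN
    rw [← hRw, key, mul_assoc, e2, mul_one]
  have hdegΦ' : WeilGroup.deg (Φ ^ (-1 : ℤ)) = 1 := by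
    rw [zpow_neg_one, WeilGroup.deg_inv hmul huniq, hΦ]; norm_num
  set q : ℕ := IsNonarchimedeanLocalField.residueFieldCard (v.adicCompletion K) with hqdef
  have hAN : A * Nm = (q : PadicAlgCl ℓ) • (Nm * A) := by
    have hc := r.conj_N (Φ ^ (-1 : ℤ))
    rw [hdegΦ', zpow_one] at hc
    have := congrArg LinearMap.toMatrix' hc
    rw [LinearMap.toMatrix'_comp, LinearEquiv.map_smul, LinearMap.toMatrix'_comp] at this
    exact this
  have hAunit : IsUnit A := by
    have h2 : A * LinearMap.toMatrix' (r.ρ Φ) = 1 := by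
      rw [hA, ← LinearMap.toMatrix'_mul, ← map_mul, zpow_neg_one, inv_mul_cancel, map_one, LinearMap.toMatrix'_one]
    have hdet : A.det * (LinearMap.toMatrix' (r.ρ Φ)).det = 1 := by rw [← Matrix.det_mul, h2, Matrix.det_one]
    exact (Matrix.isUnit_iff_isUnit_det A).mpr (isUnit_iff_ne_zero.mpr fun h0 => zero_ne_one (by rw [h0, zero_mul] at hdet; exact hdet))
  have hq1 : 1 < q := IsNonarchimedeanLocalField.one_lt_residueFieldCard _
  have hq0 : (q : PadicAlgCl ℓ) ≠ 0 := Nat.cast_ne_zero.mpr (by omega)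
  have hqk : ∀ k : ℕ, 0 < k → (q : PadicAlgCl ℓ) ^ k ≠ 1 := by
    intro k hk h
    have : (q ^ k : ℕ) = 1 := by exact_mod_cast h
    exact (Nat.one_lt_pow hk.ne' hq1).ne' this
  -- (3) `charpoly ρ'(σ) = charpoly ρ'(g⁻¹σg) = charpoly (A·exp(sN)) = charpoly A`
  have hconj : FramedRep.charpoly ρ' σ = (A * IsNilpotent.exp (s • Nm)).charpoly := by
    have eσ : σ = g * (g⁻¹ * σ * g) * g⁻¹ := by group
    rw [FramedRep.charpoly, eσ, map_mul, map_mul, map_inv, Units.val_mul, Units.val_mul, Matrix.coe_units_inv,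
      Matrix.charpoly_units_conj, hval, hM]
  rw [hconj, charpoly_mul_exp_smul A Nm hAunit hNmn hq0 hqk hAN s]
  -- (4) the exact `q`-pair among the roots of `charpoly A`
  obtain ⟨μ, hμ0, hμ, hqμ⟩ := exists_root_pair A Nm hAunit hNm0 hq0 hAN
  have hP0 : A.charpoly ≠ 0 := (Matrix.charpoly_monic A).ne_zero
  have hne : (q : PadicAlgCl ℓ) * μ ≠ μ := by
    intro h
    exact hqk 1 one_pos (by rw [pow_one]; exact (mul_eq_right₀ hμ0).mp h)
  refine ⟨(q : PadicAlgCl ℓ) * μ, μ, ?_, by rw [hqdef, residueFieldCard_adicCompletion_eq]⟩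
  rw [Multiset.le_iff_subset (by simp [hne])]
  intro x hx
  simp only [Multiset.insert_eq_cons, Multiset.mem_cons, Multiset.mem_singleton] at hx
  rcases hx with rfl | rfl
  · exact (Polynomial.mem_roots hP0).mpr hqμ
  · exact (Polynomial.mem_roots hP0).mpr hμ

/-- **THE EDGE: `S5 ⟸ CRD ∧ P ∧ L∤R ∧ IWD-A ∧ IWD-B1a ∧ IWD-B1b ∧ IWD-B2`.**  The gen-26 residual `IwahoriDictionary` follows from the N0 host items
`CanonicalReciprocityData` (17930), `PadicMemberCompatibility` (17534; only conjunct (i), de Rham above `ℓ`, is used — it makes the avatar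
pinned-geometric), `CompatibilityAwayFromLR` (18084), the PRINT junctions IWD-A, IWD-B1a, IWD-B1b and the junction IWD-B2 (print at `n = 1`, tree at `n = 2`,
tree modulo the Jacquet–Shalika named fact at `n ≥ 3`: companion file); everything else — the Weil–Deligne algebra (unipotent inertia ⇒ parameter
trivial on inertia; `N = 0 ⇒` unramified Frobenius-semisimple parameter, by the tree's `WeilDeligneOfGaloisUnramifiedProofs`; `N ≠ 0 ⇒` exact
`q`-pair via `charpoly(A·exp(sN)) = charpoly A` and the eigenvalue ladder `μ, qμ`) — is PROVED here. -/
theorem iwahoriDictionary_of_host (hCRD : CanonicalReciprocityData) (hP : PadicMemberCompatibility)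
    (hLR : CompatibilityAwayFromLR) (hA : IwahoriFixedOfInertiaTrivialParameter) (hB1a : SphericalOfUnramifiedParameter)
    (hB1b : UnramifiedOfSphericalLocalComponent) (hB2 : SatakeOfSphericalLocalGlobal) : IwahoriDictionary := by
  intro K _ _ n hcpt hn π hL ℓ _ ι ρ' hirr hcompat v hvℓ hunip
  obtain ⟨Rec⟩ := hCRD K
  -- the avatar is pinned-geometric: unramified a.e. (Satake compatibility a.e.) and de Rham above `ℓ` (P (i))
  have hgeom : (∀ᶠ w : HeightOneSpectrum (NumberField.RingOfIntegers K) in Filter.cofinite, ρ'.IsUnramifiedAt w) ∧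
      ∀ (w : HeightOneSpectrum (NumberField.RingOfIntegers K)) (hw : ((ℓ : ℕ) : NumberField.RingOfIntegers K) ∈ w.asIdeal),
        (Literature.NumberTheory.PAdicHodge.fontainePstAdicCompletion w ℓ hw).IsDeRhamFramed (ρ'.toLocal w) :=
    ⟨hcompat.mono fun w hw => by
        obtain ⟨α, -, hur, -⟩ := hw
        exact hur,
     fun w hw => (hP K n hcpt hn π hL ℓ ι ρ' hirr hcompat w hw).1⟩
  have hLGC : Summit.Langlands.LocalGlobalCompatibleAt Rec ι π.1 ρ' v :=
    hLR K Rec n hcpt hn π hL ℓ ι ρ' hirr hgeom hcompat v hvℓ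
  obtain ⟨πv, r, rℂ, hloc, hWD, hpst, htrans, r', hr', hcl⟩ := hLGC
  have hrec : IsWeilDeligneOfLadic ((ρ'.toLocal v).toWeilGroupHom) r := hWD hvℓ
  -- the Weil inertia of `K_v` acts unipotently through `ρ'`, hence trivially through `r`, `rℂ` and `r'`
  have hunipW := weil_inertia_unipotent ρ' v hunip
  have hI : WeilGroup.IsUnramifiedRep r.ρ := wd_inertia_eq_one _ r hrec hunipW
  have hIℂ : WeilGroup.IsUnramifiedRep rℂ.ρ := htrans.isUnramifiedRep hI
  have hI' : WeilGroup.IsUnramifiedRep r'.ρ := fun u hu => (hr'.2.1 u hu).trans (hIℂ u hu)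
  refine ⟨⟨πv, hloc, hA K Rec n hcpt π v πv r' hr'.isFrobSemisimple hloc hI' hcl.symm⟩, ?_⟩
  by_cases hN0 : r.N = 0
  · -- `N = 0`: the parameter is unramified (tree), so `πv` is spherical (IWD-B1a), `π` is unramified at `v` (IWD-B1b), and IWD-B2 gives the Satake clause
    left
    obtain ⟨r'', hr''ss, hc'', hN'', hur''⟩ :=
      WeilDeligneRep.HasFrobSemisimpleClass.exists_of_isUnramifiedRep ⟨r', hr', hcl⟩ (htrans.N_eq_zero hN0) hIℂ
    have hsph := hB1a K Rec n hcpt π v πv r'' hr''ss hloc hN'' hur'' hc''.symm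
    have hπv : π.1.IsUnramifiedAt v := hB1b K n hcpt π v πv hloc hsph
    exact hB2 n hn K Rec hcpt π ℓ ι ρ' v hvℓ hπv ⟨πv, r, rℂ, hloc, hWD, hpst, htrans, r', hr', hcl⟩
  · -- `N ≠ 0`: exact `q_v`-pair
    right
    intro 𝔓 h𝔓 σ hσ
    exact qpair_of_N_ne_zero ρ' v r hrec hN0 hI h𝔓 hσ

end Main

end DictEdge

end Summit.Langlands.Langlands.Theorems.IwahoriTransient

#print axioms Summit.Langlands.Langlands.Theorems.IwahoriTransient.DictEdge.iwahoriDictionary_of_host
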